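import Literature.Computability.Cryptography.RegevReductionOneSampleStage
import Literature.Computability.Cryptography.RegevBootstrapDiscrete
import Literature.Computability.Cryptography.RegevBootstrapWidth
import Literature.Computability.Cryptography.LWEHybridT2Prog
import Literature.Computability.Cryptography.LWEPrimePowerAmplifier
import Literature.Algebra.EuclideanLattices.RegevUniqueSVP
import Literature.Algebra.EuclideanLattices.RegevUSVPPre
import Literature.Algebra.EuclideanLattices.DualGridSolverMachine
import Literature.Algebra.EuclideanLattices.IntegerMatrixInverseMachine
import Literature.Algebra.EuclideanLattices.RegevRadiusSearch
import Literature.Computability.Complexity.CountingHierarchyProofs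
import Literature.Computability.Cryptography.LiuPassOWFProgram
import Literature.Computability.QuantumComplexity.HidingGoodEvent
import HarnessLib

/-!
# Regev 2009, Lemma 3.2 — the classical bootstrap sampler, as a machine

The residual `regev2009_lemma_3_2_sampler` of `RegevReductionStageResiduals.lean` (the one
classical input of the one-sample stage of Regev's quantum reduction `LWE ≤ SIVP`,
`RegevReductionOneSampleStage.lean`) asks for a deterministic polynomial-time machine `boot`
which, on the code of an instance `(B, ρ)` of `GapSVP` and a block of uniform coins, writes the
code of an integer coefficient vector whose law (read back in lattice coordinates) is within a
negligible `ν(n)` of the discrete Gaussian `D_{L(B),ρ}` whenever `B` is nonsingular and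
`ρ > 2^{2n} λₙ(L(B))` — Regev 2009, Lemma 3.2 (arXiv:2401.03703, p. 15): "there is an efficient
classical sampler from `D_{L,r}` for `r > 2^{2n} λₙ(L)`", proved there by LLL-reducing the basis,
sampling a continuous Gaussian and rounding it off (Babai) to the lattice.

This file builds that machine and proves the residual (`regev2009_lemma_3_2_sampler_holds`).
The machine (`bootList`, computed on codes by `bootList_codeFP`):
1. LLL-reduces the instance basis (`LLLMachine.lllMachineF`, LLL82 (1.26)/(1.12); output rows
   `b'ᵢ` with `‖b'ᵢ‖ ≤ 2ⁿ λₙ(L)`, `Regev2009.norm_le_two_pow_mul_successiveMinimum_of_isLLLReduced`);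
2. computes the width record of the exact Bernoulli rejection sampler of BLPRS13 §5 / GPV08 §4.1
   at `θ = n/A²`, `A = bootA ρ n` (so that its target width `A√(π/n)` is within a factor
   `1 + 2/2ⁿ` of `ρ`, `RegevBootstrapWidth.lean`), and draws `n` iid integer samples `gᵢ` from the
   coins (`BLPRS2013.KProg.noiseOf`, law `rejLaw`, `113(⌊√n⌋+1)/2ⁿ`-close to `D_{ℤ,A√(π/n)}`
   uniformly in `A`, `BLPRS2013.tvDist_rejLaw_wide_le`);
3. rounds `g = ∑ gᵢeᵢ` off to the lattice in the reduced basis in exact integer arithmetic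
   (`roundOffL`: the integer inverse `d·B'⁻¹` of `IntegerMatrixInverseGS.lean`, floor division by
   `d`, multiplication by `B'`; it agrees with `Regev2009.roundOff` of `RegevBootstrapDiscrete.lean`,
   `roundOffL_rowsOf`), and writes the coefficient vector.
The law of step 3 on exact `D_{ℤ,s}` inputs is `π(2√n·d/s + (d/s)²) + 2⁻ⁿ`-close to `D_{L,s}`,
`d = ∑‖b'ᵢ‖ ≤ n2ⁿλₙ < n ρ/2ⁿ` (`Regev2009.tvDist_indepLaw_map_roundOff_le`); with the sampler error
and the width slack this gives `ν(n) = 241 n²/2ⁿ`.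

VALUE. A theorem about a program (a machine-checked proof that the published classical procedure
meets the typed specification), not progress on any open problem: after this file the one-sample
stage `regev2009_thm_3_1_oneSampleStage` rests on the single quantum residual
`regev2009_lemma_3_3_stepMachine` (`regev_lwe_to_sivp_quantum_holds_of_boot_of_step`).
-/

open Filter _root_.Computability Literature.Computability.Complexity Literature.Computability.Cryptography.LWE
  Literature.Algebra.EuclideanLattices Literature.Computability.QuantumComplexity
  Literature.Probability.Distributions
open scoped Real

namespace Literature.Computability.Cryptography

namespace Regev2009

open BLPRS2013 BLPRS2013.KProg GaussRejMachine DualGrid Literature.Computability.Complexity.CodeFP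
  Literature.Computability.Complexity.MachinPi

/-! ### Babai round-off in exact list arithmetic -/

/-- **Round-off in list arithmetic**: for basis rows `rows` (an `n × n` integer matrix `B'` with
integer inverse data `d·B'⁻¹ = invCols`, `d = invDen`) and an integer vector `g`, the coefficient
vector `⌊g B'⁻¹⌋ B' = ((g · (d B'⁻¹)) div d) · B'` of the lattice vector obtained by rounding `g` off
in the basis `B'`. [cite: Babai1986, §3; Cohen1993, §2.6.3] -/
def roundOffL (rows : List (List ℤ)) (n : ℕ) (g : List ℤ) : List ℤ :=
  mulVecL (transposeL n rows) (edivL (mulVecL (GSInverse.invCols rows) g) (GSInverse.invDen rows))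

/-- The round-off list has `n` entries. [folklore] -/
theorem length_roundOffL (rows : List (List ℤ)) (n : ℕ) (g : List ℤ) : (roundOffL rows n g).length = n := by
  rw [roundOffL, length_mulVecL, length_transposeL]

/-- **Columns of the integer inverse times a vector**: `[dotZ colₖ v]ₖ = vecL (v ᵥ* (d·B⁻¹))`.
[cite: Cohen1993, §2.6.3] -/
theorem mulVecL_invCols {n : ℕ} (T : Matrix (Fin n) (Fin n) ℤ) (v : Fin n → ℤ) :
    mulVecL (GSInverse.invCols (GSInverse.rowsOf T)) (vecL v) = vecL (Matrix.vecMul v (GSInverse.invMatrix T)) := by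
  refine list_eq_of_getD (n := n) (by rw [length_mulVecL, GSInverse.length_invCols, GSInverse.length_rowsOf])
    (by simp [vecL]) fun k => ?_
  rw [getD_vecL, mulVecL, List.getD_eq_getElem _ _
      (by rw [List.length_map, GSInverse.length_invCols, GSInverse.length_rowsOf]; exact k.2),
    List.getElem_map, GSInverse.getElem_invCols,
    dotZ_eq_sum _ _ (D := n) (by rw [GSInverse.length_invCol, GSInverse.length_rowsOf]) (by simp [vecL])]
  simp only [Matrix.vecMul, dotProduct]
  exact Finset.sum_congr rfl fun t _ => by rw [getD_vecL, GSInverse.invMatrix_apply, mul_comm]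

/-- **The list round-off is `roundOff`**: on the rows of `B` and the list of `g`, `roundOffL`
returns the list of `Regev2009.roundOff B g = ⌊g B⁻¹⌋ B`. [cite: Babai1986, §3] -/
theorem roundOffL_rowsOf {n : ℕ} (B : Matrix (Fin n) (Fin n) ℤ) (g : Fin n → ℤ) :
    roundOffL (GSInverse.rowsOf B) n (vecL g) = vecL (roundOff B g) := by
  have ht : transposeL n (GSInverse.rowsOf B) = GSInverse.rowsOf B.transpose := transposeL_ofFn (fun j => B j)
  rw [roundOffL, mulVecL_invCols, edivL_vecL, ht, mulVecL_rowsOf, Matrix.mulVec_transpose]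
  rfl

/-! ### The parameters of the machine -/

/-- The tail-table length parameter of the sampler, `size n + 5` (`= rejS n = log₂ n + 6` for
`n ≥ 1`; written with `size` so that it is read off the binary numeral). [cite: BrakerskiEtAl2013, §5] -/
def bootS (n : ℕ) : ℕ := Nat.size n + 5

/-- The window exponent of the sampler at width parameter `A = bootA ρ n`: `size A + 1`
(`= wA A = log₂ A + 2`). [cite: BrakerskiEtAl2013, §5] -/
def bootW (ρ : ℚ) (n : ℕ) : ℕ := Nat.size (bootA ρ n) + 1

/-- `bootS n = rejS n` for `n ≠ 0`. [folklore] -/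
theorem bootS_eq {n : ℕ} (hn : n ≠ 0) : bootS n = rejS n := by
  unfold bootS rejS; rw [LPO.size_eq_log_succ hn]

/-- `bootW ρ n = wA (bootA ρ n)`. [folklore] -/
theorem bootW_eq (ρ : ℚ) (n : ℕ) : bootW ρ n = wA (bootA ρ n) := by
  unfold bootW wA; rw [LPO.size_eq_log_succ (bootA_pos ρ n).ne']

/-- The padding `2^{bootS n} ≤ 64 n + 32` is linear in `n` (so it can be written in unary).
[folklore] -/
theorem two_pow_bootS_le (n : ℕ) : 2 ^ bootS n ≤ 64 * n + 32 := by
  unfold bootS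
  rcases Nat.eq_zero_or_pos n with rfl | hn
  · simp
  · have hsz : 0 < Nat.size n := Nat.size_pos.2 hn
    have h1 : 2 ^ (Nat.size n - 1) ≤ n := Nat.lt_size.1 (by omega)
    have h2 : 2 ^ Nat.size n = 2 * 2 ^ (Nat.size n - 1) := by
      rw [← pow_succ']; congr 1; omega
    have h3 : (2 : ℕ) ^ 5 = 32 := by norm_num
    rw [pow_add, h2, h3]; omega

/-- The number of coins the machine reads: `n · R · (w + 1 + P)` (`n` samples, `R = rejR n`
rounds each, `w + 1 + P` coins a round). [cite: BrakerskiEtAl2013, §5] -/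
def bootCoins (ρ : ℚ) (n : ℕ) : ℕ := n * (rejR n * (bootW ρ n + 1 + n))

/-- The sampler record of the machine: `θ = n/A²` (`A = bootA ρ n`), centre `0`, `s = bootS n`,
`N = s + n + 2`, `P = n`, window `w = bootW ρ n`, `R = rejR n` rounds. [cite: BrakerskiEtAl2013, §5] -/
def bootCtx (ρ : ℚ) (n : ℕ) : RejCtx :=
  rejCtxOf (thetaA (bootA ρ n) n) 0 (bootS n) (bootS n + n + 2) n (bootW ρ n) (rejR n)

/-- The LLL-reduced instance written by `LLLMachine.lllMachineF` (`lllMachineF_encode`; equal to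
`I.lllReduce` on nonsingular instances, `LatticeInstance.lllReduce_eq_capRun`).
[cite: LenstraLenstraLovasz1982, (1.26)] -/
def lllOf (I : LatticeInstance) : LatticeInstance :=
  ⟨I.n, ((capStep (lllBudget I.encode.length))^[lllBudget I.encode.length] (lllStart I.basis)).b⟩

/-- **The output list of the bootstrap machine** on instance `x = (B, ρ)` and coins `c`: the
round-off, in the LLL-reduced basis, of the `n` sampler outputs read off the first `bootCoins`
coins. [cite: Regev2009, Lemma 3.2 (proof, p. 15)] -/
def bootList (x : GapSVPInstance) (c : List Bool) : List ℤ :=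
  roundOffL (Regev2004.rowsOf (lllOf x.1)) x.1.n (noiseOf (bootCtx x.2 x.1.n) x.1.n (c.take (bootCoins x.2 x.1.n)))

/-- The output list has `n` entries. [folklore] -/
theorem length_bootList (x : GapSVPInstance) (c : List Bool) : (bootList x c).length = x.1.n :=
  length_roundOffL _ _ _

/-- The output coefficient vector of the bootstrap machine. [cite: Regev2009, Lemma 3.2 (proof, p. 15)] -/
def bootVec (x : GapSVPInstance) (c : List Bool) : Fin x.1.n → ℤ := ofL x.1.n (bootList x c)

/-- The list of `n` iid noise samples has length `n`. [folklore] -/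
theorem length_noiseFlat (θ : ℚ) (s N P w R n : ℕ) (coins : List Bool) :
    (noiseFlat θ s N P w R n coins).length = n := by
  simp [noiseFlat]

/-! ### The machine on codes -/

/-- The width parameter `A = bootA ρ n = ⌊√round(ρ²n/π⁻ₙ)⌋ + 2` is computed in polynomial time from
the instance code (exact rational arithmetic, Machin `π`, `Nat.sqrt`). [cite: BorweinBorwein1987, §11.1; Cohen1993, §1.7] -/
theorem bootA_codeFP : CodeFP GapSVPInstance.encode natE (fun x : GapSVPInstance => bootA x.2 x.1.n) := by
  have hn : CodeFP GapSVPInstance.encode unE (fun x : GapSVPInstance => x.1.n) := GapCodes.svpNUn_codeFP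
  have hρ : CodeFP GapSVPInstance.encode encodeRat (fun x : GapSVPInstance => x.2) :=
    ⟨Brick.sndF, Brick.sndF_mem_FP, fun p => Brick.sndF_boolPair _ _⟩
  have hnN : CodeFP GapSVPInstance.encode natE (fun x : GapSVPInstance => x.1.n) := (natOfUn.comp hn :)
  have hnQ : CodeFP GapSVPInstance.encode encodeRat (fun x : GapSVPInstance => (x.1.n : ℚ)) :=
    (ratOfIntNat.comp ((intOfNat.comp hnN).pair (const _ 1))).congr fun x => by simp
  have hpi : CodeFP GapSVPInstance.encode encodeRat (fun x : GapSVPInstance => piApprox x.1.n) :=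
    (codeFP_piApprox.comp hn :)
  have hpow : CodeFP GapSVPInstance.encode natE (fun x : GapSVPInstance => 2 * 2 ^ x.1.n) :=
    (natMul.comp ((const _ 2).pair (natPow.comp ((const _ 2).pair hn))) :)
  have hcorr : CodeFP GapSVPInstance.encode encodeRat (fun x : GapSVPInstance => (1 : ℚ) / (2 * 2 ^ x.1.n)) :=
    (ratOfIntNat.comp ((const _ (1 : ℤ)).pair hpow)).congr fun x => by push_cast; rfl
  have hpl : CodeFP GapSVPInstance.encode encodeRat (fun x : GapSVPInstance => piLower x.1.n) :=
    (ratAdd.comp (hpi.pair (ratMul.comp ((const _ (-1 : ℚ)).pair hcorr)))).congr fun x => by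
      show piApprox x.1.n + (-1) * (1 / (2 * 2 ^ x.1.n)) = piLower x.1.n
      rw [piLower]; ring
  have hws : CodeFP GapSVPInstance.encode encodeRat (fun x : GapSVPInstance => widthSq x.2 x.1.n) :=
    (ratDiv.comp ((ratMul.comp ((ratMul.comp (hρ.pair hρ)).pair hnQ)).pair hpl)).congr fun x => by
      show x.2 * x.2 * (x.1.n : ℚ) / piLower x.1.n = widthSq x.2 x.1.n
      rw [widthSq, sq]
  exact (natAdd.comp ((natSqrt.comp (intToNat.comp (ratRound.comp hws))).pair (const _ 2)) :)

/-- The window exponent `bootW ρ n = size A + 1`, in unary, from the instance code. [folklore] -/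
theorem bootW_codeFP : CodeFP GapSVPInstance.encode unE (fun x : GapSVPInstance => bootW x.2 x.1.n) :=
  (unSucc.comp (natSizeU'_codeFP.comp bootA_codeFP) :)

/-- The round count `rejR n = 96(⌊√n⌋+1)n`, in unary, from the instance code. [folklore] -/
theorem rejR_codeFP : CodeFP GapSVPInstance.encode unE (fun x : GapSVPInstance => rejR x.1.n) := by
  have hn : CodeFP GapSVPInstance.encode unE (fun x : GapSVPInstance => x.1.n) := GapCodes.svpNUn_codeFP
  have hsq : CodeFP GapSVPInstance.encode unE (fun x : GapSVPInstance => Nat.sqrt x.1.n) :=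
    unOfNatLe hn (natSqrt.comp (natOfUn.comp hn) :) fun x => Nat.sqrt_le_self _
  exact (unMulU_codeFP.comp ((unMulU_codeFP.comp ((const _ 96).pair (unSucc.comp hsq))).pair hn) :)

/-- The coin count `bootCoins ρ n`, in unary, from the instance code. [folklore] -/
theorem bootCoins_codeFP : CodeFP GapSVPInstance.encode unE (fun x : GapSVPInstance => bootCoins x.2 x.1.n) := by
  have hn : CodeFP GapSVPInstance.encode unE (fun x : GapSVPInstance => x.1.n) := GapCodes.svpNUn_codeFP
  exact (unMulU_codeFP.comp (hn.pair (unMulU_codeFP.comp (rejR_codeFP.pair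
    (unAdd.comp ((unSucc.comp bootW_codeFP).pair hn))))) :)

/-- **The sampler record is computed in polynomial time from the instance code** (`θ = n/A²` exactly,
the unary fields under linear rulers: `2^{bootS n} ≤ 64n + 32`). [cite: BrakerskiEtAl2013, §5] -/
theorem bootCtx_codeFP : CodeFP GapSVPInstance.encode rejCtxE (fun x : GapSVPInstance => bootCtx x.2 x.1.n) := by
  have hn : CodeFP GapSVPInstance.encode unE (fun x : GapSVPInstance => x.1.n) := GapCodes.svpNUn_codeFP
  have hnN : CodeFP GapSVPInstance.encode natE (fun x : GapSVPInstance => x.1.n) := (natOfUn.comp hn :)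
  have hnQ : CodeFP GapSVPInstance.encode encodeRat (fun x : GapSVPInstance => (x.1.n : ℚ)) :=
    (ratOfIntNat.comp ((intOfNat.comp hnN).pair (const _ 1))).congr fun x => by simp
  have hAQ : CodeFP GapSVPInstance.encode encodeRat (fun x : GapSVPInstance => (bootA x.2 x.1.n : ℚ)) :=
    (ratOfIntNat.comp ((intOfNat.comp bootA_codeFP).pair (const _ 1))).congr fun x => by simp
  have hθ : CodeFP GapSVPInstance.encode encodeRat (fun x : GapSVPInstance => thetaA (bootA x.2 x.1.n) x.1.n) :=
    (ratDiv.comp (hnQ.pair (ratMul.comp (hAQ.pair hAQ)))).congr fun x => by rw [thetaA, sq]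
  have hs : CodeFP GapSVPInstance.encode unE (fun x : GapSVPInstance => bootS x.1.n) :=
    (unAdd.comp ((natSizeU'_codeFP.comp hnN).pair (const _ 5)) :)
  have hN : CodeFP GapSVPInstance.encode unE (fun x : GapSVPInstance => bootS x.1.n + x.1.n + 2) :=
    (unAdd.comp ((unAdd.comp (hs.pair hn)).pair (const _ 2)) :)
  have hpadN : CodeFP GapSVPInstance.encode natE (fun x : GapSVPInstance => 2 ^ bootS x.1.n) :=
    (natPow.comp ((const _ 2).pair hs) :)
  have hr : CodeFP GapSVPInstance.encode unE (fun x : GapSVPInstance => 64 * x.1.n + 32) :=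
    ((unPolyU_codeFP (Polynomial.C 64 * Polynomial.X + Polynomial.C 32)).comp hn).congr fun x => by simp
  have hpad : CodeFP GapSVPInstance.encode unE (fun x : GapSVPInstance => 2 ^ bootS x.1.n) :=
    unOfNatLe hr hpadN fun x => two_pow_bootS_le _
  exact ((hθ.pair ((const _ (0 : ℚ)).pair (hs.pair (hN.pair (hn.pair hpad))))).pair (bootW_codeFP.pair rejR_codeFP) :)

/-- The LLL machine computes `lllOf` on instance codes. [cite: LenstraLenstraLovasz1982, (1.26)] -/
theorem lllOf_codeFP : CodeFP LatticeInstance.encode LatticeInstance.encode lllOf :=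
  ⟨LLLMachine.lllMachineF, LLLMachine.lllMachineF_mem_FP, LLLMachine.lllMachineF_encode⟩

/-- The input code of the machine: `⟨code (B, ρ), coins⟩`. [folklore] -/
abbrev inE : GapSVPInstance × List Bool → List Bool := pairE GapSVPInstance.encode strE

/-- **The output list of the bootstrap machine is computed in polynomial time** (LLL, the record,
the `n` rejection samples, the integer inverse, floor division, the product with the basis).
[cite: Regev2009, Lemma 3.2 (proof, p. 15); LenstraLenstraLovasz1982, (1.26); Cohen1993, §2.6.3] -/
theorem bootList_codeFP : CodeFP inE (rawE intE) (fun p => bootList p.1 p.2) := by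
  have hx : CodeFP inE GapSVPInstance.encode (fun p => p.1) := fst _ _
  have hc : CodeFP inE strE (fun p => p.2) := snd _ _
  have hI : CodeFP GapSVPInstance.encode LatticeInstance.encode (fun x : GapSVPInstance => x.1) :=
    ⟨Brick.fstF, Brick.fstF_mem_FP, fun p => Brick.fstF_boolPair _ _⟩
  have hn : CodeFP inE unE (fun p => p.1.1.n) := (GapCodes.svpNUn_codeFP.comp hx :)
  have hrows : CodeFP inE GSInverse.rowsE (fun p => Regev2004.rowsOf (lllOf p.1.1)) :=
    (RegevRoutine.instRows.comp (lllOf_codeFP.comp (hI.comp hx)) :)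
  have hctx : CodeFP inE rejCtxE (fun p => bootCtx p.1.2 p.1.1.n) := (bootCtx_codeFP.comp hx :)
  have hW : CodeFP inE unE (fun p => bootCoins p.1.2 p.1.1.n) := (bootCoins_codeFP.comp hx :)
  have hcoins : CodeFP inE strE (fun p => p.2.take (bootCoins p.1.2 p.1.1.n)) := (strTake.comp (hW.pair hc) :)
  have hg : CodeFP inE (rawE intE)
      (fun p => noiseOf (bootCtx p.1.2 p.1.1.n) p.1.1.n (p.2.take (bootCoins p.1.2 p.1.1.n))) :=
    (noiseOf_codeFP.comp ((hctx.pair hn).pair hcoins) :)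
  have hcoef : CodeFP inE (rawE intE) (fun p =>
      edivL (mulVecL (GSInverse.invCols (Regev2004.rowsOf (lllOf p.1.1)))
        (noiseOf (bootCtx p.1.2 p.1.1.n) p.1.1.n (p.2.take (bootCoins p.1.2 p.1.1.n))))
        (GSInverse.invDen (Regev2004.rowsOf (lllOf p.1.1)))) :=
    (edivL_codeFP.comp ((mulVecL_codeFP.comp ((GSInverse.invCols_codeFP.comp hrows).pair hg)).pair
      (GSInverse.invDen_codeFP.comp hrows)) :)
  have hout : CodeFP inE (rawE intE) (fun p => mulVecL (transposeL p.1.1.n (Regev2004.rowsOf (lllOf p.1.1)))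
      (edivL (mulVecL (GSInverse.invCols (Regev2004.rowsOf (lllOf p.1.1)))
        (noiseOf (bootCtx p.1.2 p.1.1.n) p.1.1.n (p.2.take (bootCoins p.1.2 p.1.1.n))))
        (GSInverse.invDen (Regev2004.rowsOf (lllOf p.1.1))))) :=
    (mulVecL_codeFP.comp ((transposeL_codeFP.comp (hn.pair hrows)).pair hcoef) :)
  exact hout.congr fun p => by rw [bootList, roundOffL]

/-- **The bootstrap machine on codes**: input `⟨code (B, ρ), coins⟩`, output
`⟨code ⟨n, bootVec⟩, ε⟩`. [cite: Regev2009, Lemma 3.2 (proof, p. 15)] -/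
theorem boot_codeFP : CodeFP inE (pairE (pairE natE (pairE unE (rawE smE))) strE)
    (fun p => ((p.1.1.n, (p.1.1.n, bootList p.1 p.2)), ([] : List Bool))) := by
  have h : CodeFP inE (pairE natE (pairE unE (rawE smE)))
      (fun p => ((bootList p.1 p.2).length, ((bootList p.1 p.2).length, bootList p.1 p.2))) :=
    (Regev2004.outputFP.comp bootList_codeFP :)
  have h' : CodeFP inE (pairE natE (pairE unE (rawE smE))) (fun p => (p.1.1.n, (p.1.1.n, bootList p.1 p.2))) :=
    h.congr fun p => by simp only [length_bootList]
  have hnil : CodeFP inE strE (fun _ => ([] : List Bool)) := const _ _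
  exact h'.pair hnil

/-- **The coin truncation** `⟨x, c⟩ ↦ ⟨x, c[0, bootCoins)⟩` on codes. [folklore] -/
theorem trunc_codeFP : CodeFP inE inE (fun p => (p.1, p.2.take (bootCoins p.1.2 p.1.1.n))) :=
  (fst _ _).pair (strTake.comp ((bootCoins_codeFP.comp (fst _ _)).pair (snd _ _)) :)

/-- Reading all the coins or only the first `bootCoins` gives the same output. [folklore] -/
theorem bootList_take (x : GapSVPInstance) (c : List Bool) :
    bootList x (c.take (bootCoins x.2 x.1.n)) = bootList x c := by
  simp only [bootList, List.take_take, min_self]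

/-! ### Sizes -/

/-- **The machine reads polynomially many coins**: `bootCoins ρ n ≤ 96 |code (B, ρ)|⁴`.
[cite: BrakerskiEtAl2013, §5] -/
theorem bootCoins_le (I : LatticeInstance) (ρ : ℚ) :
    bootCoins ρ I.n ≤ 96 * (GapSVPInstance.encode (I, ρ)).length ^ 4 := by
  set L := (GapSVPInstance.encode (I, ρ)).length with hL
  have hLge : 2 * I.encode.length + 2 * Nat.size ρ.num.natAbs + 12 ≤ L := by
    rw [hL, gapSVPInstance_encode_eq, length_boolPair, length_boolPair, length_smE]; omega
  have hn : I.n ≤ I.encode.length := RegevRoutine.n_le_length_encode I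
  have hw : bootW ρ I.n + 1 + I.n ≤ L := by
    have h := wA_bootA_le ρ I.n
    rw [← bootW_eq] at h
    omega
  have hR : rejR I.n ≤ 96 * L * L := by
    unfold rejR
    have h1 : Nat.sqrt I.n + 1 ≤ L := by have := Nat.sqrt_le_self I.n; omega
    exact Nat.mul_le_mul (Nat.mul_le_mul_left _ h1) (by omega)
  calc bootCoins ρ I.n = I.n * (rejR I.n * (bootW ρ I.n + 1 + I.n)) := rfl
    _ ≤ L * (96 * L * L * L) := Nat.mul_le_mul (by omega) (Nat.mul_le_mul hR hw)
    _ = 96 * L ^ 4 := by ring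

/-! ### The error bound -/

/-- The statistical error of the bootstrap machine, `ν(n) = 241 n² / 2ⁿ`, is negligible. [folklore] -/
theorem isNegligible_nu : IsNegligible fun n : ℕ => 241 * (n : ℝ) ^ 2 * (2⁻¹ : ℝ) ^ n := by
  have h := isNegligible_two_inv_pow.polynomial_mul (Polynomial.C (241 : ℝ) * Polynomial.X ^ 2)
  have he : (fun n : ℕ => Polynomial.eval (n : ℝ) (Polynomial.C (241 : ℝ) * Polynomial.X ^ 2) * (2⁻¹ : ℝ) ^ n) =
      fun n : ℕ => 241 * (n : ℝ) ^ 2 * (2⁻¹ : ℝ) ^ n := by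
    funext n; simp
  rw [he] at h
  exact h

/-! ### The law of the machine -/

/-- `List.ofFn v.get = v.toList` for a vector `v`. [folklore] -/
theorem ofFn_get_eq_toList {α : Type} {W : ℕ} (v : List.Vector α W) : List.ofFn v.get = v.toList := by
  conv_rhs => rw [← List.Vector.ofFn_get v]
  exact (List.Vector.toList_ofFn _).symm

/-- **The law of the bootstrap machine (Regev 2009, Lemma 3.2).** On a nonsingular instance of
dimension `n ≥ 16` and a width `ρ > 2^{2n} λₙ(L)`, the output coefficient vector on `W₀ ≥ bootCoins`
uniform coins is within `241 n²/2ⁿ` of `D_{L,ρ}` read in coordinates: the `n` samples are iid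
`rejLaw`, `n · 113(⌊√n⌋+1)/2ⁿ`-close to `D_{ℤ,S}ⁿ`, `S = A√(π/n)` (`BLPRS2013.tvDist_rejLaw_wide_le`);
their round-off is `π(2√n·d/S + (d/S)²) + 2⁻ⁿ`-close to `D_{L,S}`, `d/S ≤ n/2ⁿ` by LLL
(`tvDist_indepLaw_map_roundOff_le`, `norm_le_two_pow_mul_successiveMinimum_of_isLLLReduced`); and
`Δ(D_{L,S}, D_{L,ρ}) ≤ n(1 - ρ/S) ≤ 2n/2ⁿ` (`tvDist_discreteGaussian_le_mul_one_sub_div`, `width_slack_le`).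
[cite: Regev2009, Lemma 3.2 (proof, p. 15); LenstraLenstraLovasz1982, Prop. 1.12; GentryPeikertVaikuntanathan2008, Lemma 4.2] -/
theorem tvDist_bootVec_le {I : LatticeInstance} (hI : I.IsNonsingular) (h16 : 16 ≤ I.n) {ρ : ℚ}
    (hρ : (2 : ℝ) ^ (2 * I.n) * successiveMinimum I.lattice I.n < ρ) {W₀ : ℕ}
    (hW : bootCoins ρ I.n ≤ W₀) :
    ((PMF.uniformOfFintype (QReg W₀)).map fun c => bootVec (I, ρ) (List.ofFn c)).tvDist
        ((discreteGaussian I.lattice (ρ : ℝ) 0).map I.intCoords) ≤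
      241 * (I.n : ℝ) ^ 2 * (2⁻¹ : ℝ) ^ I.n := by
  -- the LLL-reduced basis
  obtain ⟨B', hBenc, hBL, hBred⟩ := exists_lllMachineF_encode_eq hI
  have hK : lllOf I = ⟨I.n, B'⟩ :=
    LatticeInstance.encode_injective (by rw [← hBenc]; exact (LLLMachine.lllMachineF_encode I).symm)
  have hKns := LatticeInstance.isNonsingular_of_lattice_eq hI hBL
  -- elementary facts
  have hn0 : 0 < I.n := by omega
  have hN1 : (1 : ℝ) ≤ I.n := by exact_mod_cast hn0
  have ht : (0 : ℝ) < (2 : ℝ) ^ I.n := by positivity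
  have ht1 : (1 : ℝ) ≤ (2 : ℝ) ^ I.n := one_le_pow₀ (by norm_num)
  have hlam1 : 1 ≤ successiveMinimum I.lattice I.n := one_le_successiveMinimum_n hI (by omega)
  have hρ2n : (2 : ℝ) ^ (2 * I.n) ≤ ρ :=
    (le_mul_of_one_le_right (by positivity) hlam1).trans hρ.le
  have hρ2 : (2 : ℚ) ≤ ρ := by
    have h2 : (2 : ℝ) ≤ (2 : ℝ) ^ (2 * I.n) := by
      calc (2 : ℝ) = 2 ^ 1 := by norm_num
        _ ≤ 2 ^ (2 * I.n) := pow_le_pow_right₀ (by norm_num) (by omega)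
    exact_mod_cast h2.trans hρ2n
  have hρ0 : (0 : ℚ) ≤ ρ := le_trans (by norm_num) hρ2
  have hρpos : (0 : ℝ) < ρ := lt_of_lt_of_le (by positivity) hρ2n
  -- the width
  have hA0 : 0 < bootA ρ I.n := bootA_pos ρ I.n
  have hnA : I.n ≤ bootA ρ I.n ^ 2 := le_bootA_sq hρ2 I.n
  set S : ℝ := (bootA ρ I.n : ℝ) * Real.sqrt (π / I.n) with hS_def
  have hρS : (ρ : ℝ) ≤ S := rho_le_bootWidth hρ0 hn0
  have hS0 : 0 < S := hρpos.trans_le hρS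
  -- the sampler's accuracy at the machine's parameters
  have hrej : (GaussRej.rejLaw (thetaA (bootA ρ I.n) I.n) 0 (bootS I.n) (bootS I.n + I.n + 2) I.n (bootW ρ I.n)
      (rejR I.n)).tvDist (discreteGaussianInt S 0) ≤ 113 * ((Nat.sqrt I.n : ℝ) + 1) / 2 ^ I.n := by
    have h := tvDist_rejLaw_wide_le hA0 hnA h16 (0 : ℚ)
    rw [sqrt_pi_div_thetaA hA0 hn0, Rat.cast_zero, show rejN I.n = bootS I.n + I.n + 2 by
      rw [rejN, bootS_eq hn0.ne'], ← bootS_eq hn0.ne', ← bootW_eq, show rejP I.n = I.n from rfl] at h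
    exact h
  -- the output as a function of the coins
  have hvec : ∀ c : List Bool, bootVec (I, ρ) c = roundOff B' (ofL I.n (noiseFlat (thetaA (bootA ρ I.n) I.n)
      (bootS I.n) (bootS I.n + I.n + 2) I.n (bootW ρ I.n) (rejR I.n) I.n (c.take (bootCoins ρ I.n)))) := by
    intro c
    show ofL I.n (roundOffL (Regev2004.rowsOf (lllOf I)) I.n
      (noiseOf (bootCtx ρ I.n) I.n (c.take (bootCoins ρ I.n)))) = _
    rw [hK, bootCtx, noiseOf_rejCtxOf]
    set g := noiseFlat (thetaA (bootA ρ I.n) I.n) (bootS I.n) (bootS I.n + I.n + 2) I.n (bootW ρ I.n) (rejR I.n)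
      I.n (c.take (bootCoins ρ I.n)) with hg
    have hl : g = vecL (ofL I.n g) := (vecL_ofL (length_noiseFlat _ _ _ _ _ _ _ _)).symm
    rw [hl, show Regev2004.rowsOf (⟨I.n, B'⟩ : LatticeInstance) = GSInverse.rowsOf B' from rfl, roundOffL_rowsOf]
    simp only [ofL_vecL]
  have hV : (PMF.uniformOfFintype (QReg (bootCoins ρ I.n))).map (fun c => roundOff B' (ofL I.n (noiseFlat
      (thetaA (bootA ρ I.n) I.n) (bootS I.n) (bootS I.n + I.n + 2) I.n (bootW ρ I.n) (rejR I.n) I.n (List.ofFn c)))) =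
      (indepLaw I.n fun _ => GaussRej.rejLaw (thetaA (bootA ρ I.n) I.n) 0 (bootS I.n) (bootS I.n + I.n + 2) I.n
        (bootW ρ I.n) (rejR I.n)).map (roundOff B') := by
    rw [← PMF.uniformOfFintype_map_equiv (Equiv.vectorEquivFin Bool (bootCoins ρ I.n)), PMF.map_comp]
    have hcomp : ((fun c : QReg (bootCoins ρ I.n) => roundOff B' (ofL I.n (noiseFlat (thetaA (bootA ρ I.n) I.n)
        (bootS I.n) (bootS I.n + I.n + 2) I.n (bootW ρ I.n) (rejR I.n) I.n (List.ofFn c)))) ∘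
          ⇑(Equiv.vectorEquivFin Bool (bootCoins ρ I.n))) =
        (fun l => roundOff B' (ofL I.n l)) ∘ fun v : List.Vector Bool (bootCoins ρ I.n) =>
          noiseFlat (thetaA (bootA ρ I.n) I.n) (bootS I.n) (bootS I.n + I.n + 2) I.n (bootW ρ I.n) (rejR I.n) I.n
            v.toList := by
      funext v
      show roundOff B' (ofL I.n (noiseFlat _ _ _ _ _ _ I.n (List.ofFn v.get))) = roundOff B' (ofL I.n (noiseFlat _ _ _ _ _ _ I.n v.toList))
      rw [ofFn_get_eq_toList]
    have hWeq : I.n * (rejR I.n * (bootW ρ I.n + 1 + I.n)) ≤ bootCoins ρ I.n := le_rfl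
    have hfg : ((fun l => roundOff B' (ofL I.n l)) ∘ fun es : Fin I.n → ℤ => List.ofFn es) = roundOff B' := by
      funext es
      show roundOff B' (ofL I.n (vecL es)) = roundOff B' es
      rw [ofL_vecL]
    rw [hcomp, ← PMF.map_comp, uniformVector_map_noiseFlat (W := bootCoins ρ I.n) _ _ _ _ _ _ hWeq, PMF.map_comp,
      MP12.iidPMF_eq_indepLaw, hfg]
  have hfun : (fun c : QReg W₀ => bootVec (I, ρ) (List.ofFn c)) = fun c =>
      (fun l => roundOff B' (ofL I.n (noiseFlat (thetaA (bootA ρ I.n) I.n) (bootS I.n) (bootS I.n + I.n + 2) I.n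
        (bootW ρ I.n) (rejR I.n) I.n l))) ((List.ofFn c).take (bootCoins ρ I.n)) :=
    funext fun c => hvec _
  have hlaw : (PMF.uniformOfFintype (QReg W₀)).map (fun c => bootVec (I, ρ) (List.ofFn c)) =
      (indepLaw I.n fun _ => GaussRej.rejLaw (thetaA (bootA ρ I.n) I.n) 0 (bootS I.n) (bootS I.n + I.n + 2) I.n
        (bootW ρ I.n) (rejR I.n)).map (roundOff B') := by
    rw [hfun]
    exact (StageDispatch.uniform_map_ofFn_take _ W₀ hW (fun l => roundOff B' (ofL I.n (noiseFlat
      (thetaA (bootA ρ I.n) I.n) (bootS I.n) (bootS I.n + I.n + 2) I.n (bootW ρ I.n) (rejR I.n) I.n l)))).trans hV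
  rw [hlaw]
  -- the three distances
  set rej := GaussRej.rejLaw (thetaA (bootA ρ I.n) I.n) 0 (bootS I.n) (bootS I.n + I.n + 2) I.n (bootW ρ I.n) (rejR I.n)
    with hrej_def
  set dG := discreteGaussianInt S 0 with hdG
  have hT1 : ((indepLaw I.n fun _ => rej).map (roundOff B')).tvDist ((indepLaw I.n fun _ => dG).map (roundOff B')) ≤
      226 * (I.n : ℝ) ^ 2 / 2 ^ I.n := by
    refine (PMF.tvDist_map_le_holds _ _ _).trans ((tvDist_indepLaw_le I.n _ _).trans ?_)
    rw [Finset.sum_const, Finset.card_univ, Fintype.card_fin, nsmul_eq_mul]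
    have hs : ((Nat.sqrt I.n : ℕ) : ℝ) ≤ I.n := by exact_mod_cast Nat.sqrt_le_self _
    calc (I.n : ℝ) * rej.tvDist dG ≤ I.n * (113 * ((Nat.sqrt I.n : ℝ) + 1) / 2 ^ I.n) :=
        mul_le_mul_of_nonneg_left hrej (by positivity)
      _ = (113 * I.n * ((Nat.sqrt I.n : ℝ) + 1)) / 2 ^ I.n := by ring
      _ ≤ 226 * (I.n : ℝ) ^ 2 / 2 ^ I.n := div_le_div_of_nonneg_right (by nlinarith) ht.le
  have hd : (∑ i, ‖intVecToEuclidean I.n (B' i)‖) ≤ I.n * (2 ^ I.n * successiveMinimum I.lattice I.n) := by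
    have hb : ∀ i, ‖intVecToEuclidean I.n (B' i)‖ ≤ 2 ^ I.n * successiveMinimum I.lattice I.n := by
      intro i
      have hLb : latticeOfBasis (LatticeInstance.basisOfIsNonsingular hKns) = I.lattice := by
        rw [← hBL, LatticeInstance.lattice_eq_span_basisOfIsNonsingular hKns]
      have h := Literature.Algebra.EuclideanLattices.Regev2009.norm_le_two_pow_mul_successiveMinimum_of_isLLLReduced
        (LatticeInstance.basisOfIsNonsingular hKns) (by rw [LatticeInstance.coe_basisOfIsNonsingular]; exact hBred) i
      rw [hLb, LatticeInstance.coe_basisOfIsNonsingular] at h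
      exact h
    calc (∑ i, ‖intVecToEuclidean I.n (B' i)‖) ≤ ∑ _i : Fin I.n, 2 ^ I.n * successiveMinimum I.lattice I.n :=
        Finset.sum_le_sum fun i _ => hb i
      _ = I.n * (2 ^ I.n * successiveMinimum I.lattice I.n) := by
        rw [Finset.sum_const, Finset.card_univ, Fintype.card_fin, nsmul_eq_mul]
  have hu : (∑ i, ‖intVecToEuclidean I.n (B' i)‖) / S ≤ (I.n : ℝ) / 2 ^ I.n := by
    rw [div_le_iff₀ hS0]
    have h22 : (2 : ℝ) ^ (2 * I.n) = 2 ^ I.n * 2 ^ I.n := by rw [two_mul, pow_add]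
    calc (∑ i, ‖intVecToEuclidean I.n (B' i)‖) ≤ I.n * (2 ^ I.n * successiveMinimum I.lattice I.n) := hd
      _ = (I.n : ℝ) / 2 ^ I.n * (2 ^ (2 * I.n) * successiveMinimum I.lattice I.n) := by
        rw [h22]; field_simp
      _ ≤ (I.n : ℝ) / 2 ^ I.n * S := mul_le_mul_of_nonneg_left (hρ.le.trans hρS) (by positivity)
  have hu0 : 0 ≤ (∑ i, ‖intVecToEuclidean I.n (B' i)‖) / S :=
    div_nonneg (Finset.sum_nonneg fun i _ => norm_nonneg _) hS0.le
  have hT2 : ((indepLaw I.n fun _ => dG).map (roundOff B')).tvDist ((discreteGaussian I.lattice S 0).map I.intCoords) ≤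
      13 * (I.n : ℝ) ^ 2 / 2 ^ I.n := by
    refine (tvDist_indepLaw_map_roundOff_le hI B' hBL hS0).trans ?_
    set u := (∑ i, ‖intVecToEuclidean I.n (B' i)‖) / S with hu_def
    have hsq : Real.sqrt (I.n : ℝ) ≤ I.n := by
      calc Real.sqrt (I.n : ℝ) ≤ Real.sqrt ((I.n : ℝ) ^ 2) := Real.sqrt_le_sqrt (by nlinarith)
        _ = I.n := Real.sqrt_sq (by positivity)
    have h1 : 2 * Real.sqrt (I.n : ℝ) * u ≤ 2 * (I.n : ℝ) ^ 2 / 2 ^ I.n := by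
      calc 2 * Real.sqrt (I.n : ℝ) * u ≤ 2 * (I.n : ℝ) * ((I.n : ℝ) / 2 ^ I.n) :=
          mul_le_mul (by linarith) hu hu0 (by positivity)
        _ = 2 * (I.n : ℝ) ^ 2 / 2 ^ I.n := by ring
    have h2 : u ^ 2 ≤ (I.n : ℝ) ^ 2 / 2 ^ I.n := by
      calc u ^ 2 ≤ ((I.n : ℝ) / 2 ^ I.n) ^ 2 := pow_le_pow_left₀ hu0 hu 2
        _ = (I.n : ℝ) ^ 2 / 2 ^ I.n * (1 / 2 ^ I.n) := by ring
        _ ≤ (I.n : ℝ) ^ 2 / 2 ^ I.n * 1 :=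
          mul_le_mul_of_nonneg_left ((div_le_one ht).2 ht1) (by positivity)
        _ = (I.n : ℝ) ^ 2 / 2 ^ I.n := mul_one _
    have h3 : (2⁻¹ : ℝ) ^ I.n ≤ (I.n : ℝ) ^ 2 / 2 ^ I.n := by
      rw [inv_pow, ← one_div]
      exact div_le_div_of_nonneg_right (by nlinarith) ht.le
    have hq3 : (0 : ℝ) ≤ 2 * (I.n : ℝ) ^ 2 / 2 ^ I.n + (I.n : ℝ) ^ 2 / 2 ^ I.n := by positivity
    calc π * (2 * Real.sqrt (I.n : ℝ) * u + u ^ 2) + (2⁻¹ : ℝ) ^ I.n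
        ≤ π * (2 * (I.n : ℝ) ^ 2 / 2 ^ I.n + (I.n : ℝ) ^ 2 / 2 ^ I.n) + (I.n : ℝ) ^ 2 / 2 ^ I.n :=
          add_le_add (mul_le_mul_of_nonneg_left (add_le_add h1 h2) Real.pi_pos.le) h3
      _ ≤ 4 * (2 * (I.n : ℝ) ^ 2 / 2 ^ I.n + (I.n : ℝ) ^ 2 / 2 ^ I.n) + (I.n : ℝ) ^ 2 / 2 ^ I.n :=
          add_le_add (mul_le_mul_of_nonneg_right Real.pi_le_four hq3) le_rfl
      _ = 13 * (I.n : ℝ) ^ 2 / 2 ^ I.n := by ring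
  have hT3 : ((discreteGaussian I.lattice S 0).map I.intCoords).tvDist
      ((discreteGaussian I.lattice (ρ : ℝ) 0).map I.intCoords) ≤ 2 * (I.n : ℝ) ^ 2 / 2 ^ I.n := by
    haveI : IsZLattice ℝ I.lattice := LatticeInstance.isZLattice_of_isNonsingular hI
    refine (PMF.tvDist_map_le_holds _ _ _).trans
      ((tvDist_discreteGaussian_le_mul_one_sub_div I.lattice hρpos hρS).trans ?_)
    rw [finrank_euclideanSpace_fin]
    calc (I.n : ℝ) * (1 - (ρ : ℝ) / S) ≤ 2 * I.n / (2 : ℝ) ^ I.n := width_slack_le h16 hρ2n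
      _ ≤ 2 * (I.n : ℝ) ^ 2 / 2 ^ I.n := div_le_div_of_nonneg_right (by nlinarith) ht.le
  calc ((indepLaw I.n fun _ => rej).map (roundOff B')).tvDist ((discreteGaussian I.lattice (ρ : ℝ) 0).map I.intCoords)
      ≤ ((indepLaw I.n fun _ => rej).map (roundOff B')).tvDist ((indepLaw I.n fun _ => dG).map (roundOff B')) +
          ((indepLaw I.n fun _ => dG).map (roundOff B')).tvDist ((discreteGaussian I.lattice (ρ : ℝ) 0).map I.intCoords) :=
        PMF.tvDist_triangle_holds _ _ _
    _ ≤ ((indepLaw I.n fun _ => rej).map (roundOff B')).tvDist ((indepLaw I.n fun _ => dG).map (roundOff B')) +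
          (((indepLaw I.n fun _ => dG).map (roundOff B')).tvDist ((discreteGaussian I.lattice S 0).map I.intCoords) +
            ((discreteGaussian I.lattice S 0).map I.intCoords).tvDist
              ((discreteGaussian I.lattice (ρ : ℝ) 0).map I.intCoords)) :=
        add_le_add le_rfl (PMF.tvDist_triangle_holds _ _ _)
    _ ≤ 226 * (I.n : ℝ) ^ 2 / 2 ^ I.n + (13 * (I.n : ℝ) ^ 2 / 2 ^ I.n + 2 * (I.n : ℝ) ^ 2 / 2 ^ I.n) :=
        add_le_add hT1 (add_le_add hT2 hT3)
    _ = 241 * (I.n : ℝ) ^ 2 * (2⁻¹ : ℝ) ^ I.n := by rw [inv_pow]; ring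

end Regev2009

/-! ### Regev 2009, Lemma 3.2, proved -/

open Literature.Computability.Complexity.CodeFP Literature.Algebra.EuclideanLattices.DualGrid in
/-- **Regev 2009, Lemma 3.2 — the bootstrap sampler exists (the residual `regev2009_lemma_3_2_sampler`
of the one-sample stage is a theorem).** The machine is `H ∘ T`: truncate the coins to the
`bootCoins` the sampler reads (`trunc_codeFP`), then run the bootstrap machine (`boot_codeFP`:
LLL, the exact rejection sampler of BLPRS13 §5 at width `bootA ρ n · √(π/n) ∈ [ρ, ρ(1 + 2/2ⁿ)]`,
Babai round-off in the reduced basis); FORMAT from the code equations (output length through the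
FP length bound of `H` at the truncated input, `exists_poly_length_le_of_mem_FP`), LAW =
`Regev2009.tvDist_bootVec_le` with `ν(n) = 241 n²/2ⁿ`. VALUE: a theorem about a program, not progress on an
open problem — with it, `regev_lwe_to_sivp_quantum_holds_of_boot_of_step` rests on the single
quantum residual `regev2009_lemma_3_3_stepMachine`.
[cite: Regev2009, Lemma 3.2 (p. 15); Babai1986, §3; LenstraLenstraLovasz1982, (1.26), Prop. 1.12; GentryPeikertVaikuntanathan2008, Lemma 4.2] -/
theorem regev2009_lemma_3_2_sampler_holds : regev2009_lemma_3_2_sampler := by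
  obtain ⟨H, hH, hHs⟩ := Regev2009.boot_codeFP
  obtain ⟨T, hT, hTs⟩ := Regev2009.trunc_codeFP
  obtain ⟨pH, hpH⟩ := exists_poly_length_le_of_mem_FP hH
  have hout : ∀ (I : LatticeInstance) (ρ : ℚ) (c : List Bool),
      H (T (boolPair (GapSVPInstance.encode (I, ρ)) c)) = boolPair (Regev2009.vecCode I.n (Regev2009.bootVec (I, ρ) c)) [] := by
    intro I ρ c
    have h1 : T (boolPair (GapSVPInstance.encode (I, ρ)) c) =
        boolPair (GapSVPInstance.encode (I, ρ)) (c.take (Regev2009.bootCoins ρ I.n)) := by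
      simpa only [pairE_apply, strE, id_eq] using hTs ((I, ρ), c)
    have h2 : H (boolPair (GapSVPInstance.encode (I, ρ)) (c.take (Regev2009.bootCoins ρ I.n))) =
        boolPair (pairE natE (pairE unE (rawE smE)) (I.n, (I.n, Regev2009.bootList (I, ρ) (c.take (Regev2009.bootCoins ρ I.n))))) [] := by
      simpa only [pairE_apply, strE, id_eq] using hHs ((I, ρ), c.take (Regev2009.bootCoins ρ I.n))
    rw [h1, h2, Regev2009.bootList_take, Regev2009.vecCode, Regev2004.encodeIntVec_eq_pairE,
      show List.ofFn (Regev2009.bootVec (I, ρ) c) = Regev2009.bootList (I, ρ) c from vecL_ofL (Regev2009.length_bootList _ _)]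
  have htrunc : ∀ (I : LatticeInstance) (ρ : ℚ) (c : List Bool),
      (T (boolPair (GapSVPInstance.encode (I, ρ)) c)).length ≤
        2 * (GapSVPInstance.encode (I, ρ)).length + 2 + 96 * (GapSVPInstance.encode (I, ρ)).length ^ 4 := by
    intro I ρ c
    have h1 : T (boolPair (GapSVPInstance.encode (I, ρ)) c) =
        boolPair (GapSVPInstance.encode (I, ρ)) (c.take (Regev2009.bootCoins ρ I.n)) := by
      simpa only [pairE_apply, strE, id_eq] using hTs ((I, ρ), c)
    rw [h1, length_boolPair]
    have h2 := List.length_take_le (Regev2009.bootCoins ρ I.n) c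
    have h3 := Regev2009.bootCoins_le I ρ
    omega
  refine ⟨H ∘ T, Polynomial.C 96 * Polynomial.X ^ 4,
    pH.comp (2 * Polynomial.X + 2 + Polynomial.C 96 * Polynomial.X ^ 4),
    fun n => 241 * (n : ℝ) ^ 2 * (2⁻¹ : ℝ) ^ n, comp_mem_FP hH hT, Regev2009.isNegligible_nu, ?_, ?_⟩
  · intro I ρ c
    refine ⟨Regev2009.bootVec (I, ρ) c, hout I ρ c, ?_⟩
    calc (Regev2009.vecCode I.n (Regev2009.bootVec (I, ρ) c)).length ≤ (boolPair (Regev2009.vecCode I.n (Regev2009.bootVec (I, ρ) c)) []).length := by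
          rw [length_boolPair]; omega
      _ = (H (T (boolPair (GapSVPInstance.encode (I, ρ)) c))).length := by rw [hout]
      _ ≤ pH.eval (T (boolPair (GapSVPInstance.encode (I, ρ)) c)).length := hpH _
      _ ≤ pH.eval (2 * (GapSVPInstance.encode (I, ρ)).length + 2 + 96 * (GapSVPInstance.encode (I, ρ)).length ^ 4) :=
          TM2Iter.eval_mono _ (htrunc I ρ c)
      _ = (pH.comp (2 * Polynomial.X + 2 + Polynomial.C 96 * Polynomial.X ^ 4)).eval
            (GapSVPInstance.encode (I, ρ)).length := by
          simp [Polynomial.eval_comp]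
  · refine Filter.eventually_atTop.2 ⟨16, fun n hn I ρ hIn hI hρ => ?_⟩
    subst hIn
    have hfun : (fun c : QReg ((Polynomial.C 96 * Polynomial.X ^ 4 : Polynomial ℕ).eval
        (GapSVPInstance.encode (I, ρ)).length) =>
          decodeLatticeVector I.n ((H ∘ T) (boolPair (GapSVPInstance.encode (I, ρ)) (List.ofFn c)))) =
        fun c => Regev2009.bootVec (I, ρ) (List.ofFn c) := by
      funext c
      rw [Function.comp_apply, hout, Regev2009.vecCode, decodeLatticeVector_boolPair]
    rw [hfun]
    exact Regev2009.tvDist_bootVec_le hI hn hρ (by simpa using Regev2009.bootCoins_le I ρ)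

/-! ### The quantum reductions, on the step machine alone -/

/-- **`LWE ≤ SIVP` (quantum, Regev 2009 Thm 3.1 + Lemma 3.17) from the step machine alone.** With
Lemma 3.2 proved (`regev2009_lemma_3_2_sampler_holds`), the named fact
`regev_lwe_to_sivp_quantum q α m` follows from the single quantum residual
`regev2009_lemma_3_3_stepMachine q α` (one iterative step `D_{L,r} ↦ D_{L,r√n/(αq)}` as a uniform
quantum machine, Regev 2009 Lemma 3.3). VALUE: bookkeeping — the open content is exactly `hS`.
[cite: Regev2009, Theorem 3.1, Lemma 3.2, Lemma 3.3, Lemma 3.17] -/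
theorem regev_lwe_to_sivp_quantum_holds_of_step (q : ℕ → ℕ) [∀ n, NeZero (q n)] (α : ℕ → ℝ)
    (m : ℕ → ℕ) (hS : regev2009_lemma_3_3_stepMachine q α) : regev_lwe_to_sivp_quantum q α m :=
  regev_lwe_to_sivp_quantum_holds_of_boot_of_step q α m regev2009_lemma_3_2_sampler_holds hS

/-- **`LWE ≤ GapSVP` (quantum, Regev 2009 Thm 3.1 + Lemma 3.20) from the step machine alone.**
[cite: Regev2009, Theorem 3.1, Lemma 3.2, Lemma 3.3, Lemma 3.20] -/
theorem regev_lwe_to_gapSVP_quantum_holds_of_step (q : ℕ → ℕ) [∀ n, NeZero (q n)] (α : ℕ → ℝ)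
    (m : ℕ → ℕ) (hS : regev2009_lemma_3_3_stepMachine q α) : regev_lwe_to_gapSVP_quantum q α m :=
  regev_lwe_to_gapSVP_quantum_holds_of_boot_of_step q α m regev2009_lemma_3_2_sampler_holds hS

end Literature.Computability.Cryptography
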